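import Literature.Probability.RandomPlanarGeometry.RectangleModulusProofs
import Literature.Probability.Percolation.QuadCrossingSquareModel

/-!
# Box exhaustion for the collinear half-plane Cardy statement, part 4: the Schwarz–Christoffel box

Support file (line `Sketch`, stub `stub_collinearCardy`, crux `HalfPlaneMarkDensityLaw`,
stmt-CriticalPhenomena-5661; transfer `RectilinearCardy → stub_collinearCardy`).

The conformal side of the box exhaustion, entirely from the tree's Schwarz–Christoffel theory of
the rectangle (`RectangleSCIntegrand` … `RectangleModulusProofs`): with `k = 1/2`,
`K = K(k²)`, `H = K(1-k²)`, the map `F_k = scrFun k` is a conformal equivalence of `ℍₒ` onto the box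
`(-K, K) × (0, H)` whose boundary values on `(-1, 1)` are the REAL points `G(u) = ellipticF (k²) u`
of the bottom side (`tendsto_scrFun_ofReal`), `G` strictly increasing and continuous on `[-1,1]`,
`G 0 = 0`, `G' (0) = 1` (`hasDerivAt_ellipticF_zero`). Hence (`exists_scBox`): for every strictly
increasing `u : Fin 4 → (-1, 1)` the box with the four COLLINEAR bottom marks `G (u i)` is a conformal
rectangle (an axis-parallel rectangle, so an instance of `RectilinearCardy`) with arcs `0`, `2` the
bottom segments `[G u₀, G u₁] × {0}`, `[G u₂, G u₃] × {0}` and uniformizing datum `(F_k, u)` — its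
Cardy cross-ratio is `crossRatio u`. The rectangle is built from the tree's `rectDomain` (boundary =
closed polygon through the corners) translated by `iH/2`, with marks on the first edge.
-/

noncomputable section

namespace Summit.CriticalPhenomena.CardyFormulaZ2.Cruxes.HalfPlaneMarkDensityLaw.SketchLine

open Set Filter Topology Complex
open UpperHalfPlane (upperHalfPlaneSet isOpen_upperHalfPlaneSet)
open Literature.Probability.RandomPlanarGeometry

namespace BoxExhaustion

/-! ## The bottom side of the model rectangle -/

/-- On `[0, 1/4]` the closed polygon through the corners of `(-K, K) × (-B, B)` runs along the bottom
side: `t ↦ (8Kt - K, -B)`. [folklore] -/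
theorem polygonLoop_rectVerts_bottom {K B : ℝ} {t : ℝ} (ht : t ∈ Icc (0 : ℝ) (1 / 4)) :
    polygonLoop (rectVerts K B) t = ⟨8 * K * t - K, -B⟩ := by
  have h4 : (4 : ℝ) * t ∈ Icc (0 : ℝ) 1 := ⟨by linarith [ht.1], by linarith [ht.2]⟩
  have key := polygonLoop_apply_div (l := rectVerts K B) (k := 0) (by simp [rectVerts]) h4
  have e : (((0 : ℕ) : ℝ) + 4 * t) / ((rectVerts K B).length : ℝ) = t := by
    simp [rectVerts]
  rw [e] at key
  rw [key]
  apply Complex.ext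
  · simp [rectVerts, AffineMap.lineMap_apply_module']; ring
  · simp [rectVerts, AffineMap.lineMap_apply_module']

/-- The image of a parameter interval inside `[0, 1/4]` is the corresponding piece of the bottom
side. [folklore] -/
theorem image_polygonLoop_rectVerts_Icc {K B : ℝ} (hK : 0 < K) {m₀ m₁ : ℝ} (hm : 0 ≤ m₀)
    (hm1 : m₁ ≤ 1 / 4) :
    polygonLoop (rectVerts K B) '' Icc m₀ m₁ =
      {z : ℂ | z.im = -B ∧ z.re ∈ Icc (8 * K * m₀ - K) (8 * K * m₁ - K)} := by
  ext z
  simp only [mem_image, mem_setOf_eq]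
  constructor
  · rintro ⟨t, ht, rfl⟩
    rw [polygonLoop_rectVerts_bottom ⟨hm.trans ht.1, ht.2.trans hm1⟩]
    exact ⟨rfl, ⟨by nlinarith [ht.1], by nlinarith [ht.2]⟩⟩
  · rintro ⟨him, hre0, hre1⟩
    refine ⟨(z.re + K) / (8 * K), ⟨?_, ?_⟩, ?_⟩
    · rw [le_div_iff₀ (by positivity)]; linarith
    · rw [div_le_iff₀ (by positivity)]; linarith
    · rw [polygonLoop_rectVerts_bottom ⟨div_nonneg (by nlinarith) (by positivity),
        by rw [div_le_iff₀ (by positivity)]; nlinarith⟩]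
      apply Complex.ext
      · simp only; field_simp; ring
      · simp only [him]

/-! ## The box with four collinear bottom marks as a conformal rectangle -/

/-- **The box `(-K, K) × (0, H)` with four marks `p₀ < p₁ < p₂ < p₃` on its bottom side is a conformal
rectangle** whose arc `0` is `[p₀, p₁] × {0}` and arc `2` is `[p₂, p₃] × {0}` (built from the tree's
`rectDomain K (H/2)` — boundary the closed polygon through the corners, counterclockwise from the
bottom-left one — with marks `(pᵢ + K)/(8K)` on the first edge, translated by `iH/2`). [folklore] -/
theorem exists_bottomRect {K H : ℝ} (hK : 0 < K) (hH : 0 < H) (p : Fin 4 → ℝ) (hp : StrictMono p)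
    (h0 : -K < p 0) (h3 : p 3 < K) :
    ∃ R : ConformalRectangle, R.carrier = Ioo (-K) K ×ℂ Ioo 0 H ∧
      R.arc 0 = {z : ℂ | z.im = 0 ∧ z.re ∈ Icc (p 0) (p 1)} ∧
      R.arc 2 = {z : ℂ | z.im = 0 ∧ z.re ∈ Icc (p 2) (p 3)} ∧ ∀ i, R.pt i = p i := by
  have hH2 : 0 < H / 2 := by linarith
  have hpK : ∀ i, -K < p i ∧ p i < K := fun i =>
    ⟨lt_of_lt_of_le h0 (hp.monotone (Fin.zero_le i)), lt_of_le_of_lt (hp.monotone (Fin.le_last i)) h3⟩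
  have h8K : 0 < 8 * K := by positivity
  let Rs : ConformalRectangle :=
    { toJordanDomain := rectDomain K (H / 2) hK hH2
      mark := fun i => (p i + K) / (8 * K)
      strictMono_mark := fun i j hij => div_lt_div_of_pos_right (by linarith [hp hij]) h8K
      mark_mem := fun i => ⟨div_nonneg (by linarith [(hpK i).1]) h8K.le,
        by rw [div_lt_one h8K]; linarith [(hpK i).2]⟩ }
  have hmark : ∀ i, Rs.mark i = (p i + K) / (8 * K) := fun i => rfl
  have hmark0 : ∀ i, 0 ≤ Rs.mark i := fun i => (Rs.mark_mem i).1
  have hmark4 : ∀ i, Rs.mark i ≤ 1 / 4 := fun i => by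
    rw [hmark, div_le_iff₀ h8K]; linarith [(hpK i).2]
  have hval : ∀ i, 8 * K * Rs.mark i - K = p i := fun i => by
    rw [hmark]; field_simp; ring
  set c : ℂ := ((H / 2 : ℝ) : ℂ) * I with hc
  have hc_re : c.re = 0 := by simp [hc]
  have hc_im : c.im = H / 2 := by simp [hc]
  -- the arcs of the symmetric rectangle
  have harc : ∀ (i : Fin 4) (hi : i.val + 1 < 4),
      Rs.arc i = {z : ℂ | z.im = -(H / 2) ∧ z.re ∈ Icc (p i) (p ⟨i.val + 1, hi⟩)} := by
    intro i hi
    rw [MarkedDomain.arc, MarkedDomain.nextMark_of_lt Rs i hi]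
    show polygonLoop (rectVerts K (H / 2)) '' Icc (Rs.mark i) (Rs.mark ⟨i.val + 1, hi⟩) = _
    rw [image_polygonLoop_rectVerts_Icc hK (hmark0 i) (hmark4 _), hval, hval]
  -- membership in translated bottom pieces
  have htrans : ∀ (s₀ s₁ : ℝ), (Homeomorph.addRight c) '' {z : ℂ | z.im = -(H / 2) ∧ z.re ∈ Icc s₀ s₁} =
      {z : ℂ | z.im = 0 ∧ z.re ∈ Icc s₀ s₁} := by
    intro s₀ s₁
    ext z
    simp only [Homeomorph.coe_addRight, mem_image, mem_setOf_eq]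
    constructor
    · rintro ⟨w, ⟨hwim, hwre⟩, rfl⟩
      exact ⟨by rw [add_im, hwim, hc_im]; ring, by rwa [add_re, hc_re, add_zero]⟩
    · rintro ⟨hzim, hzre⟩
      refine ⟨z - c, ⟨by rw [sub_im, hzim, hc_im]; ring, by rwa [sub_re, hc_re, sub_zero]⟩, by ring⟩
  refine ⟨Rs.map (Homeomorph.addRight c), ?_, ?_, ?_, ?_⟩
  · -- carrier
    rw [MarkedDomain.carrier_map]
    ext z
    simp only [Homeomorph.coe_addRight, mem_image]
    constructor
    · rintro ⟨w, hw, rfl⟩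
      have hw' : w ∈ symRect K (H / 2) := hw
      rw [mem_symRect] at hw'
      rw [mem_reProdIm, add_re, add_im, hc_re, hc_im, add_zero]
      exact ⟨hw'.1, by linarith [hw'.2.1], by linarith [hw'.2.2]⟩
    · intro hz
      rw [mem_reProdIm] at hz
      refine ⟨z - c, ?_, by ring⟩
      show z - c ∈ symRect K (H / 2)
      rw [mem_symRect, sub_re, sub_im, hc_re, hc_im, sub_zero]
      exact ⟨hz.1, by linarith [hz.2.1], by linarith [hz.2.2]⟩
  · rw [MarkedDomain.arc_map, harc 0 (by decide), htrans]; rfl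
  · rw [MarkedDomain.arc_map, harc 2 (by decide), htrans]; rfl
  · intro i
    rw [MarkedDomain.pt_map, Homeomorph.coe_addRight]
    show polygonLoop (rectVerts K (H / 2)) (Rs.mark i) + c = p i
    rw [polygonLoop_rectVerts_bottom ⟨hmark0 i, hmark4 i⟩, hval]
    apply Complex.ext
    · simp [hc_re]
    · simp [hc_im]

/-! ## The Schwarz–Christoffel uniformizing datum with prescribed real prevertices -/

/-- **Uniformizing datum with collinear marks.** If the carrier of `R` is the Schwarz–Christoffel box
`(-K(k²), K(k²)) × (0, K(1-k²))` and its marks are the bottom points `F(k²; uᵢ)`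
(`-1 < u₀ < u₁ < u₂ < u₃ < 1`), then `(F_k, u)` is a uniformizing datum of `R`: `F_k = scrFun k` is a
conformal equivalence `ℍₒ → R` (`scrFun_bijOn`) with boundary value `F(k²; uᵢ)` at `uᵢ`
(`tendsto_scrFun_ofReal`). [folklore] -/
theorem exists_isUniformizing_of_bottom_marks {k : ℝ} (hk0 : 0 < k) (hk1 : k < 1)
    (R : ConformalRectangle)
    (hcar : R.carrier = Ioo (-ellipticK (k ^ 2)) (ellipticK (k ^ 2)) ×ℂ Ioo 0 (ellipticK (1 - k ^ 2)))
    (u : Fin 4 → ℝ) (hu : StrictMono u) (hu1 : ∀ i, u i ∈ Ioo (-1 : ℝ) 1)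
    (hpt : ∀ i, R.pt i = (ellipticF (k ^ 2) (u i) : ℂ)) :
    ∃ φ : ConformalEquiv upperHalfPlaneSet R.carrier, R.IsUniformizing φ u := by
  have hbij : BijOn (scrFun k) upperHalfPlaneSet R.carrier := by
    rw [hcar]; exact scrFun_bijOn hk0 hk1
  have hdiff : DifferentiableOn ℂ (scrFun k) upperHalfPlaneSet :=
    differentiableOn_scrFun_upperHalfPlaneSet hk0.le hk1.le
  have hderiv : ∀ z ∈ upperHalfPlaneSet, deriv (scrFun k) z ≠ 0 := by
    intro z hz
    rw [(hasDerivAt_scrFun_of_mem hk0.le hk1.le hz).deriv]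
    exact scrDeriv_ne_zero hk0.le hk1.le (upperHalfPlaneSet_subset_scrDomain hz)
  have hinv : DifferentiableOn ℂ (Function.invFunOn (scrFun k) upperHalfPlaneSet) R.carrier := by
    rw [← hbij.image_eq]
    exact Complex.differentiableOn_invFunOn_image isOpen_upperHalfPlaneSet hdiff hbij.injOn hderiv
  refine ⟨ConformalEquiv.ofBijOn (scrFun k) hdiff hbij hinv, Or.inl hu, fun i => ?_⟩
  show Tendsto (scrFun k) (𝓝[upperHalfPlaneSet] ((u i : ℝ) : ℂ)) (𝓝 (R.pt i))
  rw [hpt i]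
  exact tendsto_scrFun_ofReal hk0.le hk1.le (hu1 i)

/-- **`G = F((1/2)²; ·)` has derivative `1` at `0`** (`F_k′(0) = f_k(0) = 1`, real part of the complex
derivative of `scrFun`). [folklore] -/
theorem hasDerivAt_ellipticF_zero : HasDerivAt (ellipticF ((1 / 2 : ℝ) ^ 2)) 1 0 := by
  have hk0 : (0 : ℝ) ≤ 1 / 2 := by norm_num
  have hk1 : (1 / 2 : ℝ) ≤ 1 := by norm_num
  have h := hasDerivAt_scrFun hk0 hk1 zero_mem_scrDomain
  rw [scrDeriv_zero] at h
  have h0 : HasDerivAt (scrFun (1 / 2)) 1 ((0 : ℝ) : ℂ) := by rw [Complex.ofReal_zero]; exact h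
  have h' := h0.real_of_complex
  rw [Complex.one_re] at h'
  refine h'.congr_of_eventuallyEq ?_
  have hmem : Ioo (-1 : ℝ) 1 ∈ 𝓝 (0 : ℝ) := Ioo_mem_nhds (by norm_num) (by norm_num)
  filter_upwards [hmem] with x hx
  rw [scrFun_ofReal hk0 hk1 hx, ofReal_re]

/-- **The Schwarz–Christoffel box** (`k = 1/2`, `K = K(k²)`, `H = K(1-k²)`, `G = F(k²; ·)`): `G` maps
`[-1, 1]` into `[-K, K]`, and for every strictly increasing `u : Fin 4 → (-1, 1)` the box
`(-K, K) × (0, H)` with the collinear bottom marks `G (u i)` is a conformal rectangle with arcs `0`,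
`2` the bottom segments `[G u₀, G u₁] × {0}`, `[G u₂, G u₃] × {0}` and uniformizing datum
`(F_k, u)`. [folklore] -/
theorem exists_scBox :
    ∃ K H : ℝ, 0 < K ∧ 0 < H ∧
      (∀ v ∈ Icc (-1 : ℝ) 1, ellipticF ((1 / 2 : ℝ) ^ 2) v ∈ Icc (-K) K) ∧
      ∀ u : Fin 4 → ℝ, StrictMono u → (∀ i, u i ∈ Ioo (-1 : ℝ) 1) →
        ∃ R : ConformalRectangle, R.carrier = Ioo (-K) K ×ℂ Ioo 0 H ∧
          R.arc 0 = {z : ℂ | z.im = 0 ∧ z.re ∈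
            Icc (ellipticF ((1 / 2 : ℝ) ^ 2) (u 0)) (ellipticF ((1 / 2 : ℝ) ^ 2) (u 1))} ∧
          R.arc 2 = {z : ℂ | z.im = 0 ∧ z.re ∈
            Icc (ellipticF ((1 / 2 : ℝ) ^ 2) (u 2)) (ellipticF ((1 / 2 : ℝ) ^ 2) (u 3))} ∧
          ∃ φ : ConformalEquiv upperHalfPlaneSet R.carrier, R.IsUniformizing φ u := by
  have hk0 : (0 : ℝ) < 1 / 2 := by norm_num
  have hk1 : (1 / 2 : ℝ) < 1 := by norm_num
  have hm0 : (0 : ℝ) ≤ (1 / 2 : ℝ) ^ 2 := by positivity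
  have hm1 : (1 / 2 : ℝ) ^ 2 < 1 := by norm_num
  refine ⟨ellipticK ((1 / 2 : ℝ) ^ 2), ellipticK (1 - (1 / 2 : ℝ) ^ 2), ellipticK_sq_pos hk0 hk1,
    ellipticK_one_sub_sq_pos hk0 hk1, fun v hv => ellipticF_mem_Icc hm0 hm1 hv, ?_⟩
  intro u hu hu1
  set p : Fin 4 → ℝ := fun i => ellipticF ((1 / 2 : ℝ) ^ 2) (u i) with hp
  have hpmono : StrictMono p := fun i j hij =>
    strictMonoOn_ellipticF hm0 hm1 (Ioo_subset_Icc_self (hu1 i)) (Ioo_subset_Icc_self (hu1 j)) (hu hij)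
  obtain ⟨R, hRc, hR0, hR2, hRpt⟩ := exists_bottomRect (ellipticK_sq_pos hk0 hk1)
    (ellipticK_one_sub_sq_pos hk0 hk1) p hpmono (ellipticF_mem_Ioo hm0 hm1 (hu1 0)).1
    (ellipticF_mem_Ioo hm0 hm1 (hu1 3)).2
  refine ⟨R, hRc, hR0, hR2, ?_⟩
  exact exists_isUniformizing_of_bottom_marks hk0 hk1 R hRc u hu hu1 fun i => by rw [hRpt i]

end BoxExhaustion

/-- Registered stub of this support file (part 4 of the box exhaustion): the Schwarz–Christoffel box
with collinear bottom marks. [folklore] -/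
theorem stub_boxExhaustion_scBox :
    ∃ K H : ℝ, 0 < K ∧ 0 < H ∧
      (∀ v ∈ Icc (-1 : ℝ) 1, ellipticF ((1 / 2 : ℝ) ^ 2) v ∈ Icc (-K) K) ∧
      ∀ u : Fin 4 → ℝ, StrictMono u → (∀ i, u i ∈ Ioo (-1 : ℝ) 1) →
        ∃ R : ConformalRectangle, R.carrier = Ioo (-K) K ×ℂ Ioo 0 H ∧
          R.arc 0 = {z : ℂ | z.im = 0 ∧ z.re ∈
            Icc (ellipticF ((1 / 2 : ℝ) ^ 2) (u 0)) (ellipticF ((1 / 2 : ℝ) ^ 2) (u 1))} ∧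
          R.arc 2 = {z : ℂ | z.im = 0 ∧ z.re ∈
            Icc (ellipticF ((1 / 2 : ℝ) ^ 2) (u 2)) (ellipticF ((1 / 2 : ℝ) ^ 2) (u 3))} ∧
          ∃ φ : ConformalEquiv upperHalfPlaneSet R.carrier, R.IsUniformizing φ u :=
  BoxExhaustion.exists_scBox

end Summit.CriticalPhenomena.CardyFormulaZ2.Cruxes.HalfPlaneMarkDensityLaw.SketchLine

end
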